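import Mathlib

/-!
# Route `NodalDiracTwist` — support `TwistCalibrationBdG`: square-root charts (holonomy, part 1)

Elementary complex analysis for the SECOND CLAUSE of `TwistCalibrationBdG` (stmt-HubbardSuperconductivity-1625):
the ground-state line bundle of the `U = 0` BdG family over twist space is, block by block, the real
line bundle of the lower eigenvector of `[[a, b], [b, -a]]`, i.e. (in the complex encoding
`p₋ = i√z/|√z|`, `z = a + ib`) the square-root (Möbius) bundle over `ℂ ∖ 0`.
* `exists_sqrt_charts`: for a unit `d`, two explicit square-root branches `c₁` (continuous off the
  closed ray `ℝ≥0·(-d)`) and `c₂` (continuous off `ℝ≥0·d`), with `c₂ = ε₁ c₁` / `c₂ = ε₂ c₁` on the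
  two open half-planes bounded by `ℝ d` and **`ε₁ ε₂ = -1`** (the monodromy of `√`);
* `re_conj_mul_pos_of_norm_sub_lt` (`‖u - v‖ < ‖u‖ ⇒ Re(conj u·v) > 0`) and the **sign-transfer
  identity** `prod_re_conj_mul_finRotate_eq`: the cyclic overlap product of unit vectors `±i s_j/|s_j|`
  equals that of the `s_j` divided by `(Π|s_j|)²` — so its SIGN may be computed with any choice of
  square roots.

Sources: standard (argument principle / two-valuedness of `√`); Hatsugai, J. Phys. Soc. Jpn. 75 (2006)
123601 (quantised Berry phases of real bundles). No definitions.
-/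

-- the mandated namespace `Summit.<Summit>.<Problem>.Theorems` repeats `HubbardSuperconductivity`
-- (single-problem summit, D-0017), which the `dupNamespace` linter flags on every declaration
set_option linter.dupNamespace false

namespace Summit.HubbardSuperconductivity.HubbardSuperconductivity.Theorems.NodalDiracTwist

open Complex Set Filter Topology
open scoped ComplexConjugate

/-- The explicit square-root branch `c(w) = ν (u w)^{1/2}` squares to `w` when `ν² u = 1`.
[folklore] -/
theorem sqrt_branch_sq {ν u : ℂ} (h : ν ^ 2 * u = 1) (w : ℂ) :
    (ν * (u * w) ^ (2⁻¹ : ℂ)) ^ 2 = w := by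
  rw [mul_pow, Complex.cpow_ofNat_inv_pow, ← mul_assoc, h, one_mul]

/-- The branch `w ↦ ν (u w)^{1/2}` (`|u| = 1`) is continuous at every `w` off the closed ray
`ℝ≥0 · ū⁻¹ = -ℝ≥0 · conj u`… precisely: at every `w` with `u w ∉ ℝ≤0`. [folklore] -/
theorem continuousAt_sqrt_branch (ν u w : ℂ) (hw : u * w ∈ slitPlane) :
    ContinuousAt (fun w => ν * (u * w) ^ (2⁻¹ : ℂ)) w := by
  refine continuousAt_const.mul ?_
  exact (continuousAt_cpow_const hw).comp (continuousAt_const.mul continuousAt_id)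

/-- For a unit `d`, `u = -conj d`: `u w ∉ slitPlane` forces `w` onto the closed ray `ℝ≥0 · d`.
[folklore] -/
theorem mem_slitPlane_of_not_mem_ray {d w : ℂ} (hd : ‖d‖ = 1)
    (hw : ¬ ∃ t : ℝ, 0 ≤ t ∧ w = t * d) : -(starRingEnd ℂ) d * w ∈ slitPlane := by
  by_contra hs
  rw [mem_slitPlane_iff, not_or, not_lt, not_not] at hs
  apply hw
  have hdd : d * (starRingEnd ℂ) d = 1 := by
    rw [Complex.mul_conj, Complex.normSq_eq_norm_sq, hd]; norm_num
  set v : ℂ := -(starRingEnd ℂ) d * w with hv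
  refine ⟨-v.re, by linarith [hs.1], ?_⟩
  have key : w = -d * v := by
    rw [hv, ← mul_assoc, show -d * -(starRingEnd ℂ) d = d * (starRingEnd ℂ) d by ring, hdd, one_mul]
  have hre : v = ((v.re : ℝ) : ℂ) := by
    apply Complex.ext
    · simp only [Complex.ofReal_re]
    · rw [Complex.ofReal_im]; exact hs.2
  rw [key]
  conv_lhs => rw [hre]
  push_cast
  ring

/-- **Two square-root charts with opposite cuts.** For a unit complex number `d` there are
square-root branches `c₁` (continuous off the closed ray `ℝ≥0·(-d)`) and `c₂` (continuous off
`ℝ≥0·d`) and signs `ε₁, ε₂` with `ε₁ ε₂ = -1` such that `c₂ = ε₁ c₁` on the open half-plane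
`Im(w conj d) > 0` and `c₂ = ε₂ c₁` on `Im(w conj d) < 0`: the monodromy of `√` around `0` is `-1`.
[folklore] -/
theorem exists_sqrt_charts (d : ℂ) (hd : ‖d‖ = 1) :
    ∃ c₁ c₂ : ℂ → ℂ, (∀ w, c₁ w ^ 2 = w) ∧ (∀ w, c₂ w ^ 2 = w) ∧
      (∀ w, (¬ ∃ t : ℝ, 0 ≤ t ∧ w = t * (-d)) → ContinuousAt c₁ w) ∧
      (∀ w, (¬ ∃ t : ℝ, 0 ≤ t ∧ w = t * d) → ContinuousAt c₂ w) ∧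
      ∃ ε₁ ε₂ : ℂ, ε₁ * ε₂ = -1 ∧
        (∀ w, 0 < (w * (starRingEnd ℂ) d).im → c₂ w = ε₁ * c₁ w) ∧
        (∀ w, (w * (starRingEnd ℂ) d).im < 0 → c₂ w = ε₂ * c₁ w) := by
  have hdn : ‖-d‖ = 1 := by rw [norm_neg, hd]
  have hdd : d * (starRingEnd ℂ) d = 1 := by
    rw [Complex.mul_conj, Complex.normSq_eq_norm_sq, hd]; norm_num
  have hd0 : d ≠ 0 := fun h => by rw [h, norm_zero] at hd; exact zero_ne_one hd
  -- the two branches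
  set ν₁ : ℂ := d ^ (2⁻¹ : ℂ) with hν₁
  set ν₂ : ℂ := (-d) ^ (2⁻¹ : ℂ) with hν₂
  have hν₁sq : ν₁ ^ 2 = d := Complex.cpow_ofNat_inv_pow _ _
  have hν₂sq : ν₂ ^ 2 = -d := Complex.cpow_ofNat_inv_pow _ _
  set c₁ : ℂ → ℂ := fun w => ν₁ * ((starRingEnd ℂ) d * w) ^ (2⁻¹ : ℂ) with hc₁
  set c₂ : ℂ → ℂ := fun w => ν₂ * (-(starRingEnd ℂ) d * w) ^ (2⁻¹ : ℂ) with hc₂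
  have h1sq : ∀ w, c₁ w ^ 2 = w := fun w => sqrt_branch_sq (by rw [hν₁sq, hdd]) w
  have h2sq : ∀ w, c₂ w ^ 2 = w := fun w =>
    sqrt_branch_sq (by rw [hν₂sq, show -d * -(starRingEnd ℂ) d = d * (starRingEnd ℂ) d by ring, hdd]) w
  have h1c : ∀ w, (¬ ∃ t : ℝ, 0 ≤ t ∧ w = t * (-d)) → ContinuousAt c₁ w := by
    intro w hw
    have := mem_slitPlane_of_not_mem_ray hdn hw
    rw [map_neg, neg_neg] at this
    exact continuousAt_sqrt_branch ν₁ _ w this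
  have h2c : ∀ w, (¬ ∃ t : ℝ, 0 ≤ t ∧ w = t * d) → ContinuousAt c₂ w := fun w hw =>
    continuousAt_sqrt_branch ν₂ _ w (mem_slitPlane_of_not_mem_ray hd hw)
  -- the half-planes avoid both rays
  have hray : ∀ w, (w * (starRingEnd ℂ) d).im ≠ 0 → ∀ s : ℂ, (s = d ∨ s = -d) →
      ¬ ∃ t : ℝ, 0 ≤ t ∧ w = t * s := by
    rintro w hw s hs ⟨t, -, rfl⟩
    apply hw
    rcases hs with rfl | rfl
    · rw [mul_assoc, hdd, mul_one, Complex.ofReal_im]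
    · rw [mul_assoc, neg_mul, hdd, mul_neg, mul_one, Complex.neg_im, Complex.ofReal_im, neg_zero]
  -- sign relation on a preconnected set avoiding the rays
  have hrel : ∀ S : Set ℂ, IsPreconnected S → (∀ w ∈ S, (w * (starRingEnd ℂ) d).im ≠ 0) →
      ∃ ε : ℂ, (ε = 1 ∨ ε = -1) ∧ ∀ w ∈ S, c₂ w = ε * c₁ w := by
    intro S hS hS'
    have hf : ContinuousOn c₂ S := fun w hw =>
      (h2c w (hray w (hS' w hw) d (Or.inl rfl))).continuousWithinAt
    have hg : ContinuousOn c₁ S := fun w hw =>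
      (h1c w (hray w (hS' w hw) (-d) (Or.inr rfl))).continuousWithinAt
    have hsq : EqOn (c₂ ^ 2) (c₁ ^ 2) S := fun w _ => by
      simp only [Pi.pow_apply, h1sq, h2sq]
    have hne : ∀ {w}, w ∈ S → c₁ w ≠ 0 := by
      intro w hw h0
      have : w = 0 := by rw [← h1sq w, h0]; ring
      apply hS' w hw
      rw [this, zero_mul, Complex.zero_im]
    rcases hS.eq_or_eq_neg_of_sq_eq hf hg hsq hne with h | h
    · exact ⟨1, Or.inl rfl, fun w hw => by rw [h hw, one_mul]⟩
    · exact ⟨-1, Or.inr rfl, fun w hw => by rw [h hw, Pi.neg_apply, neg_one_mul]⟩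
  -- the two open half-planes are convex, hence preconnected
  have hlin : IsLinearMap ℝ fun w : ℂ => (w * (starRingEnd ℂ) d).im := by
    constructor
    · intro x y; rw [add_mul, Complex.add_im]
    · intro a x
      rw [Complex.real_smul, mul_assoc, Complex.im_ofReal_mul, smul_eq_mul]
  obtain ⟨ε₁, hε₁, hε₁'⟩ := hrel {w | 0 < (w * (starRingEnd ℂ) d).im}
    (convex_halfSpace_gt hlin 0).isPreconnected (fun w hw => ne_of_gt hw)
  obtain ⟨ε₂, hε₂, hε₂'⟩ := hrel {w | (w * (starRingEnd ℂ) d).im < 0}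
    (convex_halfSpace_lt hlin 0).isPreconnected (fun w hw => ne_of_lt hw)
  refine ⟨c₁, c₂, h1sq, h2sq, h1c, h2c, ε₁, ε₂, ?_, fun w hw => hε₁' w hw, fun w hw => hε₂' w hw⟩
  -- evaluate at `w± = ± i d`
  have hwp : (Complex.I * d * (starRingEnd ℂ) d).im = 1 := by
    rw [mul_assoc, hdd, mul_one, Complex.I_im]
  have hwm : (-(Complex.I * d) * (starRingEnd ℂ) d).im = -1 := by
    rw [neg_mul, Complex.neg_im, hwp]
  have e1 := hε₁' (Complex.I * d) (by rw [Set.mem_setOf_eq, hwp]; exact one_pos)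
  have e2 := hε₂' (-(Complex.I * d)) (by rw [Set.mem_setOf_eq, hwm]; exact neg_one_lt_zero)
  -- values of the branches there
  have hu1 : (starRingEnd ℂ) d * (Complex.I * d) = Complex.I := by
    calc (starRingEnd ℂ) d * (Complex.I * d) = Complex.I * (d * (starRingEnd ℂ) d) := by ring
      _ = Complex.I := by rw [hdd, mul_one]
  have hu2 : (starRingEnd ℂ) d * (-(Complex.I * d)) = -Complex.I := by rw [mul_neg, hu1]
  have hu3 : -(starRingEnd ℂ) d * (Complex.I * d) = -Complex.I := by rw [neg_mul, hu1]
  have hu4 : -(starRingEnd ℂ) d * (-(Complex.I * d)) = Complex.I := by rw [neg_mul, hu2, neg_neg]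
  set a : ℂ := Complex.I ^ (2⁻¹ : ℂ) with ha
  set b : ℂ := (-Complex.I) ^ (2⁻¹ : ℂ) with hb
  have hasq : a ^ 2 = Complex.I := Complex.cpow_ofNat_inv_pow _ _
  have hbsq : b ^ 2 = -Complex.I := Complex.cpow_ofNat_inv_pow _ _
  have ha0 : a ≠ 0 := fun h => Complex.I_ne_zero (by rw [← hasq, h]; ring)
  have hb0 : b ≠ 0 := fun h => Complex.I_ne_zero (by
    have : -Complex.I = 0 := by rw [← hbsq, h]; ring
    exact neg_eq_zero.mp this)
  have hν₁0 : ν₁ ≠ 0 := fun h => hd0 (by rw [← hν₁sq, h]; ring)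
  have v1 : c₁ (Complex.I * d) = ν₁ * a := by simp only [hc₁]; rw [hu1]
  have v2 : c₁ (-(Complex.I * d)) = ν₁ * b := by simp only [hc₁]; rw [hu2]
  have v3 : c₂ (Complex.I * d) = ν₂ * b := by simp only [hc₂]; rw [hu3]
  have v4 : c₂ (-(Complex.I * d)) = ν₂ * a := by simp only [hc₂]; rw [hu4]
  rw [v1, v3] at e1
  rw [v2, v4] at e2
  have hprod : (ε₁ * ε₂ + 1) * (d * (a * b)) = 0 := by
    have h12 : ν₂ * b * (ν₂ * a) = ε₁ * (ν₁ * a) * (ε₂ * (ν₁ * b)) := by rw [e1, e2]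
    linear_combination (-1 : ℂ) * h12 + a * b * hν₂sq - ε₁ * ε₂ * a * b * hν₁sq
  rcases mul_eq_zero.mp hprod with h0 | h0
  · linear_combination h0
  · exfalso
    rcases mul_eq_zero.mp h0 with h0 | h0
    · exact hd0 h0
    · rcases mul_eq_zero.mp h0 with h0 | h0
      · exact ha0 h0
      · exact hb0 h0

/-! ### Overlap positivity from closeness; transfer of signs between square-root choices -/

/-- If `‖u - v‖ < ‖u‖` then the `ℝ²`-inner product `Re(conj u · v)` is positive. [folklore] -/
theorem re_conj_mul_pos_of_norm_sub_lt {u v : ℂ} (h : ‖u - v‖ < ‖u‖) :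
    0 < ((starRingEnd ℂ) u * v).re := by
  have hu : 0 < ‖u‖ := lt_of_le_of_lt (norm_nonneg _) h
  have h1 : ((starRingEnd ℂ) u * v).re = ‖u‖ ^ 2 + ((starRingEnd ℂ) u * (v - u)).re := by
    rw [mul_sub, Complex.sub_re, Complex.conj_mul', ← Complex.ofReal_pow, Complex.ofReal_re]; ring
  have h2 : |((starRingEnd ℂ) u * (v - u)).re| ≤ ‖u‖ * ‖u - v‖ := by
    refine (Complex.abs_re_le_norm _).trans ?_
    rw [norm_mul, Complex.norm_conj, norm_sub_rev]
  rw [h1]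
  nlinarith [abs_le.mp h2, mul_lt_mul_of_pos_left h hu]

/-- One factor of the cyclic product under a change of square-root choice: for
`q = ε i s/|s|`, `q' = ε' i s'/|s'|` with real signs `ε, ε'`,
`Re(conj q · q') = ε ε' Re(conj s · s') / (|s| |s'|)`. [folklore] -/
theorem re_conj_mul_of_eq_sign_mul {q q' s s' : ℂ} {ε ε' : ℝ}
    (hq : q = (ε : ℂ) * (Complex.I * s / (‖s‖ : ℂ))) (hq' : q' = (ε' : ℂ) * (Complex.I * s' / (‖s'‖ : ℂ))) :
    ((starRingEnd ℂ) q * q').re = ε * ε' / (‖s‖ * ‖s'‖) * ((starRingEnd ℂ) s * s').re := by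
  rw [hq, hq']
  have : (starRingEnd ℂ) ((ε : ℂ) * (Complex.I * s / (‖s‖ : ℂ))) * ((ε' : ℂ) * (Complex.I * s' / (‖s'‖ : ℂ))) =
      ((ε * ε' / (‖s‖ * ‖s'‖) : ℝ) : ℂ) * ((starRingEnd ℂ) s * s') := by
    simp only [map_mul, map_div₀, Complex.conj_ofReal, Complex.conj_I]
    push_cast
    by_cases hs : (‖s‖ : ℂ) = 0
    · rw [hs]; simp
    by_cases hs' : (‖s'‖ : ℂ) = 0
    · rw [hs']; simp
    field_simp
    ring_nf
    rw [Complex.I_sq]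
    ring
  rw [this, Complex.re_ofReal_mul]

/-- **Transfer of the sign of a cyclic overlap product between square-root choices.** If each unit
vector `q_i` is `± i s_i/|s_i|` (`s_i ≠ 0`), then the cyclic products `Π_i Re(conj q_i · q_{i+1})` and
`Π_i Re(conj s_i · s_{i+1})` differ by the positive factor `(Π_i |s_i|)⁻²` (the signs cancel in
pairs around the cycle). [folklore] -/
theorem prod_re_conj_mul_finRotate_eq {n : ℕ} (q s : Fin n → ℂ)
    (hrel : ∀ i, q i = Complex.I * s i / (‖s i‖ : ℂ) ∨ q i = -(Complex.I * s i / (‖s i‖ : ℂ))) :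
    ∏ i, ((starRingEnd ℂ) (q i) * q (finRotate n i)).re =
      (∏ i, ((starRingEnd ℂ) (s i) * s (finRotate n i)).re) / (∏ i, ‖s i‖) ^ 2 := by
  -- choose the signs
  have hε : ∀ i, ∃ ε : ℝ, (ε = 1 ∨ ε = -1) ∧ q i = (ε : ℂ) * (Complex.I * s i / (‖s i‖ : ℂ)) := by
    intro i
    rcases hrel i with h | h
    · exact ⟨1, Or.inl rfl, by rw [h]; push_cast; ring⟩
    · exact ⟨-1, Or.inr rfl, by rw [h]; push_cast; ring⟩
  choose ε hε1 hε2 using hε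
  have hfac : ∀ i, ((starRingEnd ℂ) (q i) * q (finRotate n i)).re =
      (ε i * ε (finRotate n i)) * ((‖s i‖ * ‖s (finRotate n i)‖)⁻¹ *
        ((starRingEnd ℂ) (s i) * s (finRotate n i)).re) := by
    intro i
    rw [re_conj_mul_of_eq_sign_mul (hε2 i) (hε2 (finRotate n i)), div_eq_mul_inv]
    ring
  have h1 : (∏ i, ε i) * ∏ i, ε (finRotate n i) = 1 := by
    rw [Equiv.prod_comp (finRotate n) ε, ← Finset.prod_mul_distrib]
    refine Finset.prod_eq_one fun i _ => ?_
    rcases hε1 i with h | h <;> rw [h] <;> norm_num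
  have h2 : ∏ i, (‖s i‖ * ‖s (finRotate n i)‖)⁻¹ = ((∏ i, ‖s i‖) ^ 2)⁻¹ := by
    rw [Finset.prod_inv_distrib, Finset.prod_mul_distrib,
      Equiv.prod_comp (finRotate n) (fun i => ‖s i‖), sq]
  simp only [hfac, Finset.prod_mul_distrib]
  rw [h1, one_mul, h2, div_eq_inv_mul]

end Summit.HubbardSuperconductivity.HubbardSuperconductivity.Theorems.NodalDiracTwist
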